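import Mathlib.GroupTheory.SpecificGroups.Dihedral
import Mathlib.Tactic.Linarith
import Summits.MatrixMultiplication.OmegaCensus.DihedralLikeLaw
import Summits.MatrixMultiplication.OmegaCensus.C2DihedralLowerBound
import HarnessLib

/-!
# `β(C₂ × D_{2k}) = 4⌊4k/3⌋ = 8⌊2k/3⌋` for `k ≢ 1 (mod 3)`

ω-census, family (b3).  Framing: lottery ticket; floor = certified bounds/negative ranges.

`C₂ × D_{2k}` (`Multiplicative (ZMod 2) × DihedralGroup k`) is the generalized dihedral group of `ℤ₂ × ℤ_k`, so the
dihedral-like law gives `|S||T||U| ≤ 4⌊2·2k/3⌋ = 4⌊4k/3⌋` for every TPP triple (`tpp_volume_le_law_c2_dihedral`),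
and the product family of `C2DihedralLowerBound.lean` gives `8⌊2k/3⌋`.  For `k ≢ 1 (mod 3)` the two agree:
**`β(C₂ × D_{2k}) = 4⌊4k/3⌋`** (`c2_dihedral_law`).  (For `k ≡ 4 (mod 6)` the value lies in
`[8⌊2k/3⌋, 8⌊2k/3⌋ + 2]`, `DihedralLawMinusOne.lean`; for `k ≡ 1 (mod 6)` the group is `D_{4k}`.)
-/

namespace Summit.MatrixMultiplication.OmegaCensus

open Literature.Combinatorics.Additive Finset

/-- **`|S||T||U| ≤ 4⌊4k/3⌋` for every TPP triple of `C₂ × D_{2k}`** (the dihedral-like law over `ℤ₂ × ℤ_k`).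
[folklore] -/
theorem tpp_volume_le_law_c2_dihedral {k : ℕ} [NeZero k]
    {S T U : Finset (Multiplicative (ZMod 2) × DihedralGroup k)} (h : TripleProductProperty S T U) :
    S.card * T.card * U.card ≤ 4 * (4 * k / 3) := by
  have key := tpp_volume_le_law_dihedralLike (A := ZMod 2 × ZMod k)
    (ρ := fun p : ZMod 2 × ZMod k => (Multiplicative.ofAdd p.1, DihedralGroup.r p.2))
    (τ := fun p : ZMod 2 × ZMod k => (Multiplicative.ofAdd p.1, DihedralGroup.sr p.2)) (c₀ := (0 : ZMod 2 × ZMod k))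
    (fun a b => by
      simp only [Prod.mk_mul_mk, DihedralGroup.r_mul_r, ← ofAdd_add, Prod.fst_add, Prod.snd_add])
    (fun a b => by
      simp only [Prod.mk_mul_mk, DihedralGroup.r_mul_sr, ← ofAdd_add, Prod.fst_sub, Prod.snd_sub]
      rw [sub_eq_add_neg b.1, ZMod.neg_eq_self_mod_two, add_comm b.1])
    (fun a b => by
      simp only [Prod.mk_mul_mk, DihedralGroup.sr_mul_r, ← ofAdd_add, Prod.fst_add, Prod.snd_add])
    (fun a b => by
      simp only [Prod.mk_mul_mk, DihedralGroup.sr_mul_sr, ← ofAdd_add, zero_add, Prod.fst_sub, Prod.snd_sub]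
      rw [sub_eq_add_neg b.1, ZMod.neg_eq_self_mod_two, add_comm b.1])
    (fun a b hab => by
      simp only [Prod.mk.injEq, DihedralGroup.r.injEq] at hab
      exact Prod.ext (Multiplicative.ofAdd.injective hab.1) hab.2)
    (fun a b hab => by
      simp only [Prod.mk.injEq, DihedralGroup.sr.injEq] at hab
      exact Prod.ext (Multiplicative.ofAdd.injective hab.1) hab.2)
    (fun a b hab => by simp at hab)
    (fun g => by
      obtain ⟨m, d⟩ := g
      cases d with
      | r i => exact Or.inl ⟨(Multiplicative.toAdd m, i), rfl⟩
      | sr i => exact Or.inr ⟨(Multiplicative.toAdd m, i), rfl⟩)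
    (by rw [Fintype.card_prod, ZMod.card, ZMod.card]; have := NeZero.ne k; omega) h
  rw [Fintype.card_prod, ZMod.card, ZMod.card] at key
  have e : 2 * (2 * k) = 4 * k := by ring
  rwa [e] at key

/-- **`β(C₂ × D_{2k}) = 4⌊4k/3⌋` for `k ≥ 3`, `k ≢ 1 (mod 3)`** (upper bound: the dihedral-like law; attained by the
product of `(C₂, 1, 1)` with the uniform dihedral family, volume `8⌊2k/3⌋ = 4⌊4k/3⌋` for these `k`). [folklore] -/
theorem c2_dihedral_law {k : ℕ} [NeZero k] (hk : 3 ≤ k) (hmod : k % 3 ≠ 1) :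
    (∀ S T U : Finset (Multiplicative (ZMod 2) × DihedralGroup k), TripleProductProperty S T U →
        S.card * T.card * U.card ≤ 4 * (4 * k / 3)) ∧
    ∃ S T U : Finset (Multiplicative (ZMod 2) × DihedralGroup k), TripleProductProperty S T U ∧
      S.card * T.card * U.card = 4 * (4 * k / 3) := by
  refine ⟨fun S T U h => tpp_volume_le_law_c2_dihedral h, ?_⟩
  obtain ⟨S, T, U, h, hvol⟩ := tpp_volume_ge_c2_dihedral k hk
  exact ⟨S, T, U, h, by omega⟩

end Summit.MatrixMultiplication.OmegaCensus
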